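import Summits.Langlands.Langlands.Theses.OrdinaryPrimeTransport
import Literature.NumberTheory.DiophantineGeometry.BcgpResiduallyA5bModular
import Literature.NumberTheory.DiophantineGeometry.AbelianVarietyOrdinaryReduction
import Literature.NumberTheory.Automorphic.IsAutomorphicAE
import HarnessLib

/-!
# Line `A5bTwoRankOne` — crux `ReciprocityUpToIrreducibility` (item stmt-Langlands-14328; routes
`route-Langlands-IrreducibilityBySelfDuality` (primary), `route-Langlands-OrdinaryPrimeTransport`)
# Forward generator G4 ladder-down, generation 24 — dial θ26: the NEWTON STRATUM AT THE PATCHING PRIME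

**Top E** = `ReciprocityUpToIrreducibility` (≃ the summit given the two Jacquet–Shalika facts,
`Theorems.IrreducibleOffSector.langlands_iff_reciprocityUpToIrreducibility_of_JS`).

**Published-copy convention (g19–g23).**  This PUBLISHED copy imports `Theses.OrdinaryPrimeTransport` and concludes
`Summit.Langlands.Langlands.Theses.OrdinaryPrimeTransport.ReciprocityUpToIrreducibility` — the `Iff.rfl`-equal copy of the
item's decl shared by the second route wanting stmt-Langlands-14328 — because the crux-write farm path cannot serve the
`Theses.IrreducibilityBySelfDuality` module (`remote:incoherent … mismatch`, 2026-08-20); the REGISTERED skeleton (the seat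
folder's `Sketch.lean`, identical modulo this one import and the decl prefix) concludes the primary decl
`Summit.Langlands.Langlands.Theses.IrreducibilityBySelfDuality.ReciprocityUpToIrreducibility` BY NAME.

**Dial θ26 (new coordinate; none of g1–g23 varies it).**  Inside clause (B) of E over `F = ℚ`, `n = 4`, restrict to the
framed duals of `V_p(B)` for abelian surfaces `B/ℚ` whose `2`-torsion is `A₅`-via-`S₅(b)` with complex conjugation of
type `(2,2)` (Boxer–Calegari–Gee–Pilloni's residual hypotheses (1)–(2), verbatim from the in-tree fact) and turn the knob
`f` = the NEWTON STRATUM OF `B` AT `2`: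
* `f = 2` — ORDINARY at `2` in BCGP's Galois form (semistable-or-good reduction, framed dual of `V₂(B)` ordinary and
  `2`-distinguished): hypothesis (3) of BCGP 2025 Thm. 8.3.2.  **FLOOR — in tree** as the named fact
  `bcgp_residuallyA5b_modular_abelianSurface` [BCGP 2025, arXiv:2502.20645, Thm. 8.3.2]; `floor_two` below is `simpa`-level.
* `f = 1` — GOOD reduction at `2` of `2`-RANK ONE (Newton slopes `0, ½, ½, 1`; "Klingen-ordinary, Siegel-non-ordinary").
  **RUNG `A5bTwoRankOne`** — open in print: BCGP prove classicality and patch ONLY on the ordinary locus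
  [arXiv:2502.20645 p. 4; Gee, arXiv:2510.02756 Rem. 3 p. 5: ordinarity "the more serious hypothesis"; §6 p. 17: relaxing it to
  a small-slope condition is listed as future work]; higher Coleman theory gives small-slope classicality only in REGULAR
  (cohomological) weight [Boxer–Pilloni, Higher Coleman theory, §3 Ex. 3.13 / §5], not in the irregular weight `(2,2)` of
  abelian surfaces.
* `f = 0` — supersingular at `2` (`A5bSupersingular`, the gap above the rung); `f ≥ 3` vacuous (`family_vacuous`).

**Shape.**  Family `A5bStratumModular f`; stubs (5): `stub_floorFact` (the floor fact itself, in print), `stub_rung`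
(`f = 1`, THE OPEN CORE), `stub_supersingular` (`f = 0`), `stub_sectorMerge` ((∀ f, stratum modular) → clause (B) of E
verbatim on the `A₅(b)`-abelian-surface sector for every `Rec`: `[F:ℚ] = 1` transport + strong multiplicity one +
cuspidality/`L`-algebraicity + full local–global compatibility), `stub_offSector` (E with (B) restricted OFF the sector —
the honest complement, summit-hard by design of a ladder line).  Composition `ReciprocityUpToIrreducibility_of` is
sorry-free (`by_cases` on the sector, `family_of` by `interval_cases`), and `reciprocityUpToIrreducibility_holds`
concludes the item's decl BY NAME.  On-path (`A5bTwoRankOne_of_Langlands`, F4) and floor (`floor_two`, F3) are proved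
here and in the companion files `A5bTwoRankOne_onpath.lean` / `A5bTwoRankOne_special.lean`.

**Tribunal kernel (planner pre-check, full tier, forward mode, floor/witness = `floor_two`):** `tk=PROVISIONAL`
(on_path ✓, real_step ✓ — floor ↛ rung, rung ↛ floor, rung not outright; witness clean; t1 kernel clean: `C → S` does
not close, `S → C` closes only through the on-path lemma; chips: carrier-unverified for the binders
`B : AbelianVariety ℚ`, `b : Basis (Fin 4) ℚ_[p] (V_p B)` — the carriers of the vendored floor fact itself —,
t4 placed-cli `ShimuraVarietyRealizationBarrier`).  BC2/BC3/BC4/BC7 probes: see the line card `A5bTwoRankOne.md`.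
Disposition: FRONTIER (capped ladder strictly below g8's rung `SymplecticOddAbelianQ2`).
-/

noncomputable section

set_option linter.dupNamespace false

open scoped MatrixGroups Matrix NumberField Classical
open Filter IsDedekindDomain IsDedekindDomain.HeightOneSpectrum CategoryTheory
open Literature.NumberTheory.Automorphic Literature.NumberTheory.GaloisRepresentations
open Literature.NumberTheory.PAdicHodge Literature.NumberTheory.DiophantineGeometry
open Literature.AlgebraicGeometry.Motives (AbelianVariety SchemeOver)
open Summit.Langlands

namespace Summit.Langlands.Langlands.Cruxes.ReciprocityUpToIrreducibility.A5bTwoRankOne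

/-! ## 1. The hypotheses of BCGP Thm. 8.3.2, the Newton strata at `2`, the modularity conclusion -/

/-- **Hypotheses (1)–(2) of BCGP 2025 Thm. 8.3.2** (verbatim from the in-tree fact): in some additive frame of
`B[2](ℚ̄)` the Galois action is through `S₅(b)` (`s5bMatrix`), every even permutation is realised (`A₅(b) ⊆ image`),
and every complex conjugation acts by a double transposition (order `2`, inside `A₅(b)`). -/
def IsResiduallyA5b (B : AbelianVariety ℚ) : Prop :=
  ∃ e : B.geomTorsion (2 : ℕ) ≃+ (Fin 4 → ZMod 2),
    (∀ g : Field.absoluteGaloisGroup ℚ, ∃ σ : Equiv.Perm (Fin 5),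
        ∀ P : B.geomTorsion (2 : ℕ), e (g • P) = s5bMatrix σ *ᵥ e P) ∧
    (∀ σ : Equiv.Perm (Fin 5), Equiv.Perm.sign σ = 1 →
        ∃ g : Field.absoluteGaloisGroup ℚ,
          ∀ P : B.geomTorsion (2 : ℕ), e (g • P) = s5bMatrix σ *ᵥ e P) ∧
    (∀ c : Field.absoluteGaloisGroup ℚ, IsComplexConjugation (algebraMap ℚ ℝ) c →
        ∃ σ : Equiv.Perm (Fin 5), σ.cycleType = {2, 2} ∧
          ∀ P : B.geomTorsion (2 : ℕ), e (c • P) = s5bMatrix σ *ᵥ e P)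

/-- **Hypothesis (3) of BCGP 2025 Thm. 8.3.2 = the ORDINARY stratum at `2` in Galois form** (verbatim from the
in-tree fact): semistable-or-good reduction at `2` (`(ρ_ℓ(τ) − 1)² = 0` for inertia `τ` at `2`, `ℓ ≠ 2`, SGA 7 IX 3.5)
and every framed dual `r₂` of `V₂(B)` ordinary and `2`-distinguished at `v ∣ 2` (Def. 1.8.8).  It CONTAINS the
geometric stratum "good ordinary (`2`-rank `2`), `2`-distinguished reduction" (Serre–Tate / Greenberg: the named fact
`ordinaryReduction_tateModule_filtration`). -/
def IsOrdinaryStratumAtTwo (B : AbelianVariety ℚ) : Prop :=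
  (∀ (ℓ : ℕ) [Fact ℓ.Prime], ℓ ≠ 2 →
    ∀ v : HeightOneSpectrum (𝓞 ℚ), ((2 : ℕ) : 𝓞 ℚ) ∈ v.asIdeal →
      ∀ τ ∈ absInertia (v.adicCompletion ℚ),
        (B.rationalTateRep ℓ (absGaloisRestrict ℚ (v.adicCompletion ℚ) τ) - 1) ^ 2 = 0) ∧
  (∀ (b₂ : Module.Basis (Fin 4) ℚ_[2] (B.rationalTateModule 2))
      (r₂ : FramedGaloisRep ℚ (PadicAlgCl 2) 4),
      (∀ g : Field.absoluteGaloisGroup ℚ,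
        (r₂ g).val =
          ((LinearMap.toMatrix b₂ b₂ (B.rationalTateRep 2 g⁻¹)).map
            (algebraMap ℚ_[2] (PadicAlgCl 2))).transpose) →
      ∀ v : HeightOneSpectrum (𝓞 ℚ), ((2 : ℕ) : 𝓞 ℚ) ∈ v.asIdeal →
        r₂.IsOrdinaryPDistinguishedAt v)

/-- **Good reduction at `v` of `p`-rank `f`**: an abelian-scheme model `𝒜` of `A` over `𝓞_{K,v}` (Serre–Tate §1,
`IsAbelianSchemeModel`) whose special fibre has exactly `p ^ f` geometric points of order dividing `p = char κ(v)`
(`specialFibrePTorsionCard`; Li–Oort §0.6: the `p`-rank).  At `f = dim A` this is LITERALLY the tree's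
`AbelianVariety.HasGoodOrdinaryReductionAt` (`hasGoodReductionOfPRankAt_dim_iff`, `Iff.rfl`). -/
def HasGoodReductionOfPRankAt {K : Type} [Field K] [NumberField K] (A : AbelianVariety K)
    (v : HeightOneSpectrum (𝓞 K)) (f : ℕ) : Prop :=
  ∃ (𝒜 : SchemeOver (valuationSubringAtPrime K v)) (_ : GrpObj 𝒜),
    IsAbelianSchemeModel A v 𝒜 ∧ specialFibrePTorsionCard v 𝒜 = residueChar v ^ f

/-- The top stratum `f = dim A` of the `p`-rank is good ORDINARY reduction (definitionally). [folklore] -/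
theorem hasGoodReductionOfPRankAt_dim_iff {K : Type} [Field K] [NumberField K] (A : AbelianVariety K)
    (v : HeightOneSpectrum (𝓞 K)) : HasGoodReductionOfPRankAt A v A.dim ↔ A.HasGoodOrdinaryReductionAt v :=
  Iff.rfl

/-- **The Newton strata at `2`, indexed by the `2`-rank `f`** (THE DIAL): `f = 2` the ordinary stratum in BCGP's
Galois form (what the printed floor assumes), `f = 1` good reduction at `2` of `2`-rank one (Newton slopes
`0, ½, ½, 1`: "Klingen-ordinary, Siegel-slope ½"), `f = 0` good supersingular reduction at `2` (all slopes `½`);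
no stratum for `f ≥ 3` (a surface has `2`-rank `≤ 2`). -/
def NewtonStratumAtTwo : ℕ → AbelianVariety ℚ → Prop
  | 0, B => ∀ v : HeightOneSpectrum (𝓞 ℚ), ((2 : ℕ) : 𝓞 ℚ) ∈ v.asIdeal → HasGoodReductionOfPRankAt B v 0
  | 1, B => ∀ v : HeightOneSpectrum (𝓞 ℚ), ((2 : ℕ) : 𝓞 ℚ) ∈ v.asIdeal → HasGoodReductionOfPRankAt B v 1
  | 2, B => IsOrdinaryStratumAtTwo B
  | _, _ => False

/-- **"`B` is modular" in the summit's `GL₄` a.e.-Satake form** (the conclusion of BCGP Thm. 8.3.2 as vendored,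
weakened by three TRUE extra hypotheses on the framed dual `r` of `V_p(B)` — irreducible (Faltings + `A₅(b)`),
unramified a.e. (Néron–Ogg–Shafarevich), de Rham above `p` for Fontaine's pinned datum (Fontaine–Faltings) — so that
clause (B) of E applies to `r` literally): for every prime `p`, every framed dual `r` of `V_p(B)` and every
`ι : ℚ̄_p ≃ ℂ` there is an automorphic representation of `GL₄(𝔸_ℚ)` whose Satake parameters give `det(X − r(Frob_v))`
at almost every `v` (`SatakeFrobCompatibleAE`). -/
def IsModularGL4 (B : AbelianVariety ℚ) : Prop :=
  ∀ (p : ℕ) [Fact p.Prime] (b : Module.Basis (Fin 4) ℚ_[p] (B.rationalTateModule p))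
    (r : FramedGaloisRep ℚ (PadicAlgCl p) 4),
    (∀ g : Field.absoluteGaloisGroup ℚ,
      (r g).val =
        ((LinearMap.toMatrix b b (B.rationalTateRep p g⁻¹)).map
          (algebraMap ℚ_[p] (PadicAlgCl p))).transpose) →
    r.toGaloisRep.IsIrreducible →
    (∀ᶠ v : HeightOneSpectrum (𝓞 ℚ) in cofinite, r.IsUnramifiedAt v) →
    (∀ (w : HeightOneSpectrum (𝓞 ℚ)) (hw : ((p : ℕ) : 𝓞 ℚ) ∈ w.asIdeal),
        (fontainePstAdicCompletion w p hw).IsDeRhamFramed (r.toLocal w)) →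
    ∀ (hcpt : isCompact_glFiniteIntegralLevel 4 ℚ) (ι : PadicAlgCl p ≃+* ℂ),
      ∃ π : AutomorphicRepData (AutomorphyDatum.gl 4 ℚ hcpt), SatakeFrobCompatibleAE ι π r

/-- **The RUNG FAMILY, dial = the `2`-rank `f`**: every residually-`A₅(b)` abelian surface `B/ℚ` in the Newton
stratum `f` at `2` is modular. -/
def A5bStratumModular (f : ℕ) : Prop :=
  ∀ B : AbelianVariety ℚ, B.dim = 2 → IsResiduallyA5b B → NewtonStratumAtTwo f B → IsModularGL4 B

/-- **THE RUNG (θ26 = 1)**: residually-`A₅(b)` abelian surfaces over `ℚ` with good reduction at `2` of `2`-RANK ONE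
(non-ordinary, Newton slopes `0, ½, ½, 1`) are modular. -/
def A5bTwoRankOne : Prop := A5bStratumModular 1

/-- **The higher rung (θ26 = 0)**: residually-`A₅(b)` abelian surfaces over `ℚ` with good SUPERSINGULAR reduction
at `2` are modular. -/
def A5bSupersingular : Prop := A5bStratumModular 0

/-! ## 2. Floor, vacuous members, the family from its strata (sorry-free) -/

/-- **F3: the family at `f = 2` IS THE FLOOR** — BCGP 2025 Thm. 8.3.2 (in-tree named fact; the three extra
hypotheses of `IsModularGL4` are discarded and the cuspidal `π` is read as an automorphic representation). -/
theorem floor_two (h : bcgp_residuallyA5b_modular_abelianSurface) : A5bStratumModular 2 := by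
  intro B hdim hres hstr p _ b r hfr _hirr _hunr _hdR hcpt ι
  obtain ⟨π, -, hπ⟩ := h B hdim hres hstr.1 hstr.2 p b r hfr hcpt ι
  exact ⟨π.1, hπ⟩

/-- No stratum above the dimension: the members `f ≥ 3` are vacuous. -/
theorem family_vacuous (f : ℕ) (hf : 3 ≤ f) : A5bStratumModular f := by
  obtain ⟨k, rfl⟩ : ∃ k, f = k + 3 := ⟨f - 3, by omega⟩
  intro B _ _ hstr
  exact (hstr : False).elim

/-- **Every stratum** from the floor fact, the rung and the supersingular rung. -/
theorem family_of (h2 : bcgp_residuallyA5b_modular_abelianSurface) (h1 : A5bTwoRankOne)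
    (h0 : A5bSupersingular) (f : ℕ) : A5bStratumModular f := by
  rcases Nat.lt_or_ge f 3 with h | h
  · interval_cases f
    · exact h0
    · exact h1
    · exact floor_two h2
  · exact family_vacuous f h

/-! ## 3. The sector of clause (B), the merge target, the off-sector complement -/

/-- **The residually-`A₅(b)` abelian-surface sector of clause (B)** at `(F, ℓ, ρ)`: `[F:ℚ] = 1` (so `F = ℚ`) and
`ρ` has the Frobenius characteristic polynomials of `r|Γ_F` for a framed dual `r` of `V_ℓ(B)`, `B/ℚ` a
residually-`A₅(b)` abelian surface lying in SOME Newton stratum `f` at `2`. -/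
def InA5bSector (F : Type) [Field F] [NumberField F] (ℓ : ℕ) [Fact ℓ.Prime] {n : ℕ}
    (ρ : FramedGaloisRep F (PadicAlgCl ℓ) n) : Prop :=
  Module.finrank ℚ F = 1 ∧
    ∃ (B : AbelianVariety ℚ) (f : ℕ), B.dim = 2 ∧ IsResiduallyA5b B ∧ NewtonStratumAtTwo f B ∧
      ∃ (b : Module.Basis (Fin 4) ℚ_[ℓ] (B.rationalTateModule ℓ)) (r : FramedGaloisRep ℚ (PadicAlgCl ℓ) 4),
        (∀ g : Field.absoluteGaloisGroup ℚ,
          (r g).val =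
            ((LinearMap.toMatrix b b (B.rationalTateRep ℓ g⁻¹)).map
              (algebraMap ℚ_[ℓ] (PadicAlgCl ℓ))).transpose) ∧
        ∀ (w : HeightOneSpectrum (𝓞 F)) (P : Polynomial (PadicAlgCl ℓ)),
          (r.restrictField F).HasFrobCharpolyAt w P → ρ.HasFrobCharpolyAt w P

/-- **Merge target**: clause (B) of E VERBATIM (cuspidal, `L`-algebraic, `Corresponds Rec ι π ρ`) for EVERY
reciprocity datum `Rec`, on the residually-`A₅(b)` abelian-surface sector. -/
def SectorGaloisToAutomorphic : Prop :=
  ∀ (F : Type) [Field F] [NumberField F] (Rec : ReciprocityData F) (n : ℕ), 0 < n →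
    ∀ (hcpt : isCompact_glFiniteIntegralLevel n F) (ℓ : ℕ) [Fact ℓ.Prime] (ι : PadicAlgCl ℓ ≃+* ℂ)
      (ρ : FramedGaloisRep F (PadicAlgCl ℓ) n),
      ρ.toGaloisRep.IsIrreducible → IsGeometricFramed Rec ρ → InA5bSector F ℓ ρ →
        ∃ π : CuspidalAutomorphicRepData n F hcpt, π.1.IsLAlgebraic ∧ Corresponds Rec ι π.1 ρ

/-- **The off-sector complement**: E (`ReciprocityUpToIrreducibility`) with clause (A) entire and clause (B)
restricted to `ρ` NOT in the residually-`A₅(b)` abelian-surface sector. -/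
def OffSectorReciprocity : Prop :=
  ∀ (F : Type) [Field F] [NumberField F], ∃ Rec : ReciprocityData F, ∀ n : ℕ, 0 < n →
    ∀ hcpt : isCompact_glFiniteIntegralLevel n F,
      (∀ π : CuspidalAutomorphicRepData n F hcpt, π.1.IsLAlgebraic →
        ∀ (ℓ : ℕ) [Fact ℓ.Prime] (ι : PadicAlgCl ℓ ≃+* ℂ),
          ∃ ρ : FramedGaloisRep F (PadicAlgCl ℓ) n, IsGeometricFramed Rec ρ ∧ Corresponds Rec ι π.1 ρ) ∧
      (∀ (ℓ : ℕ) [Fact ℓ.Prime] (ι : PadicAlgCl ℓ ≃+* ℂ) (ρ : FramedGaloisRep F (PadicAlgCl ℓ) n),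
        ρ.toGaloisRep.IsIrreducible → IsGeometricFramed Rec ρ → ¬ InA5bSector F ℓ ρ →
          ∃ π : CuspidalAutomorphicRepData n F hcpt, π.1.IsLAlgebraic ∧ Corresponds Rec ι π.1 ρ)

/-! ## 4. The five registered stubs -/

/-- The FLOOR as a named fact: BCGP 2025 Thm. 8.3.2 (in print; vendored in the tree, XL to discharge). -/
theorem stub_floorFact : bcgp_residuallyA5b_modular_abelianSurface := by
  sorry

/-- **THE RUNG (open core)**: the `2`-rank-one stratum. -/
theorem stub_rung : A5bTwoRankOne := by
  sorry

/-- The supersingular stratum (the gap above the rung). -/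
theorem stub_supersingular : A5bSupersingular := by
  sorry

/-- Sector merge: from modularity of every stratum to clause (B) of E verbatim on the sector, for every `Rec`
(`[F:ℚ] = 1` transport; strong multiplicity one and Jacquet–Shalika ⇒ cuspidal `L`-algebraic `π`; local–global
compatibility at every place). -/
theorem stub_sectorMerge : (∀ f : ℕ, A5bStratumModular f) → SectorGaloisToAutomorphic := by
  sorry

/-- E with clause (B) restricted OFF the sector (the honest complement). -/
theorem stub_offSector : OffSectorReciprocity := by
  sorry

/-! ## 5. Composition (no sorry below this line) -/

/-- **COMPOSITION — the crux BY NAME from the five stub statements.** -/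
theorem ReciprocityUpToIrreducibility_of :
    bcgp_residuallyA5b_modular_abelianSurface → A5bTwoRankOne → A5bSupersingular →
    ((∀ f : ℕ, A5bStratumModular f) → SectorGaloisToAutomorphic) → OffSectorReciprocity →
    Summit.Langlands.Langlands.Theses.OrdinaryPrimeTransport.ReciprocityUpToIrreducibility := by
  intro h2 h1 h0 hmerge hoff F _ _
  obtain ⟨Rec, hall⟩ := hoff F
  refine ⟨Rec, fun n hn hcpt => ⟨(hall n hn hcpt).1, ?_⟩⟩
  intro ℓ _ ι ρ hirr hgeo
  by_cases hsec : InA5bSector F ℓ ρ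
  · exact hmerge (family_of h2 h1 h0) F Rec n hn hcpt ℓ ι ρ hirr hgeo hsec
  · exact (hall n hn hcpt).2 ℓ ι ρ hirr hgeo hsec

/-- **THE REGISTERED SKELETON THEOREM** — the item's decl from the five registered stubs. -/
theorem reciprocityUpToIrreducibility_holds :
    Summit.Langlands.Langlands.Theses.OrdinaryPrimeTransport.ReciprocityUpToIrreducibility :=
  ReciprocityUpToIrreducibility_of stub_floorFact stub_rung stub_supersingular stub_sectorMerge stub_offSector

/-! ## 6. The rung is a consequence of the top and of the summit (sorry-free) -/

/-- `E → A5bStratumModular f` for every `f`. -/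
theorem a5bStratumModular_of_top (f : ℕ)
    (hE : Summit.Langlands.Langlands.Theses.OrdinaryPrimeTransport.ReciprocityUpToIrreducibility) :
    A5bStratumModular f := by
  intro B _hdim _hres _hstr p _ b r _hfr hirr hunr hdR hcpt ι
  obtain ⟨Rec, hall⟩ := hE ℚ
  have hB : GaloisToAutomorphic 4 Rec hcpt := (hall 4 (by norm_num) hcpt).2
  have hgeo : IsGeometricFramed Rec r := ⟨hunr, fun w hw => hdR w hw⟩
  obtain ⟨π, _hLalg, hcorr⟩ := hB p ι r hirr hgeo
  exact ⟨π.1, hcorr.1⟩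

/-- `E → rung`. -/
theorem A5bTwoRankOne_of_top
    (hE : Summit.Langlands.Langlands.Theses.OrdinaryPrimeTransport.ReciprocityUpToIrreducibility) :
    A5bTwoRankOne :=
  a5bStratumModular_of_top 1 hE

/-- `Langlands → A5bStratumModular f` for every `f` (the F4 on-path lemma). -/
theorem a5bStratumModular_of_langlands (f : ℕ) (hL : _root_.Langlands) : A5bStratumModular f := by
  intro B _hdim _hres _hstr p _ b r _hfr hirr hunr hdR hcpt ι
  obtain ⟨⟨Rec⟩, hall⟩ := hL ℚ
  have hB : GaloisToAutomorphic 4 Rec hcpt := (hall Rec 4 (by norm_num) hcpt).2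
  have hgeo : IsGeometricFramed Rec r := ⟨hunr, fun w hw => hdR w hw⟩
  obtain ⟨π, _hLalg, hcorr⟩ := hB p ι r hirr hgeo
  exact ⟨π.1, hcorr.1⟩

/-- **F4 on-path lemma**: `S → Rung`. -/
@[aesop safe apply]
theorem A5bTwoRankOne_of_Langlands (hL : _root_.Langlands) : A5bTwoRankOne :=
  a5bStratumModular_of_langlands 1 hL

end Summit.Langlands.Langlands.Cruxes.ReciprocityUpToIrreducibility.A5bTwoRankOne

end
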